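import Mathlib
import Literature.NumberTheory.LFunctions.SuzukiWeilHilbertSpace
import Literature.NumberTheory.LFunctions.SuzukiWeilModelSpace
import Literature.NumberTheory.LFunctions.LagariasXiStructureFunctionProofs
import HarnessLib

/-!
# Boundary values of `E_ξ𝖥(V(0))`-functions: `Φ/E_ξ = 𝖥ψ` a.e. on the real line

LINE 1 — LABEL: RH-FREE corpus theorem about the RH-FREE objects of the cell rh-crit/dbl
(M. Suzuki, *On the Hilbert space derived from the Weil distribution*, Canad. J. Math. 2025 =
arXiv:2301.00421v3, Lemma 5.1 and the proof of Thm. 5.7). bears_on: B-C/B-P (LADDER-RH COLUMN 6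
DBR) as corpus infrastructure. WHAT THIS IS NOT: an identification of boundary values; it
discharges no named fact and does not bear on the truth of RH.

## What is proved

`div_lagariasE_ae_eq_suzukiFourierL2`: if `ψ ∈ L²(0,∞)` (`halfLineL2 0`) and `Φ : ℂ → ℂ` is
continuous at the real points with `Φ(z) = E_ξ(z) ψ̂(z)` on the open upper half-plane
(`ψ̂ = upperHalfHat ψ`; e.g. `Φ ∈ suzukiChainSpace 0` with witness `ψ`), then
`Φ(x)/E_ξ(x) = (𝖥ψ)(x)` for almost every real `x`, where `𝖥 = suzukiFourierL2` is Suzuki's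
Fourier transform on `L²(ℝ)`. Proof: `ψ̂(· + iy) → 𝖥ψ` in `L²(ℝ)` as `y ↓ 0` (dbl-t10's
`norm_suzukiFourierL2_indicator_mul_exp_sub_lt`), hence a.e. along a subsequence, while
`ψ̂(x + iy) = Φ(x + iy)/E(x + iy) → Φ(x)/E(x)` at every real `x` with `E(x) ≠ 0` (a.e.). This is
the first step of the inclusion `E_ξ𝖥(V(0)) ⊆ 𝓗(E_ξ)` of CJM Lemma 5.1 (`Φ/E ∈ L²(ℝ)`).

## References
* M. Suzuki, Canad. J. Math. 2025 = arXiv:2301.00421v3, Lemma 5.1 p. 13, Thm. 5.7 p. 16. [Suzuki2025WeilHilbertSpace]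
-/

noncomputable section

open MeasureTheory Complex Filter Set
open scoped ComplexConjugate Topology Real ENNReal

namespace Literature.NumberTheory.LFunctions

open Literature.Analysis.DeBrangesSpaces

/-- **`Φ/E_ξ = 𝖥ψ` a.e. on `ℝ`** for `Φ = E_ξψ̂` on `ℂ₊`, `ψ ∈ L²(0,∞)`, `Φ` continuous at the real
points (`L²`-convergence of `ψ̂(·+iy)` to `𝖥ψ`, a.e. along a subsequence, against the pointwise
limit `Φ(x+iy)/E(x+iy) → Φ(x)/E(x)` off the null set of real zeros of `E_ξ`). In particular
`Φ/E_ξ ∈ L²(ℝ)`. RH-FREE. [cite: Suzuki2025WeilHilbertSpace, CJM Lemma 5.1 p. 13 (TeX l.1464–1471) and Thm. 5.7 proof p. 16] -/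
theorem div_lagariasE_ae_eq_suzukiFourierL2 {Φ : ℂ → ℂ} {ψ : Lp ℂ 2 (volume : Measure ℝ)}
    (hψ : ψ ∈ halfLineL2 0) (hΦc : ∀ x : ℝ, ContinuousAt Φ x)
    (hΦ : ∀ z : ℂ, 0 < z.im → Φ z = lagariasE z * upperHalfHat ψ z) :
    (fun x : ℝ ↦ Φ x / lagariasE x) =ᵐ[volume] (suzukiFourierL2 ψ : ℝ → ℂ) := by
  -- a sequence `y n ↓ 0` with `‖𝖥ψ_{y n} − 𝖥ψ‖ < 1/(n+1)`
  have hseq : ∀ n : ℕ, ∃ y : ℝ, 0 < y ∧ y < 1 / (n + 1 : ℝ) ∧ ∀ hy : 0 < y,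
      ‖suzukiFourierL2 ((memLp_two_indicator_mul_exp ψ hy.le).toLp _) - suzukiFourierL2 ψ‖ <
        1 / (n + 1 : ℝ) := by
    intro n
    obtain ⟨δ, hδ, h⟩ := norm_suzukiFourierL2_indicator_mul_exp_sub_lt hψ
      (by positivity : (0 : ℝ) < 1 / (n + 1 : ℝ))
    refine ⟨min (δ / 2) (1 / (2 * (n + 1 : ℝ))), by positivity, ?_, fun hy ↦ h _ hy ?_⟩
    · calc min (δ / 2) (1 / (2 * (n + 1 : ℝ))) ≤ 1 / (2 * (n + 1 : ℝ)) := min_le_right _ _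
        _ < 1 / (n + 1 : ℝ) := by
          rw [div_lt_div_iff_of_pos_left one_pos (by positivity) (by positivity)]; linarith
    · exact (min_le_left _ _).trans_lt (by linarith)
  choose y hy0 hy1 hyn using hseq
  set F : ℕ → Lp ℂ 2 (volume : Measure ℝ) := fun n ↦
    suzukiFourierL2 ((memLp_two_indicator_mul_exp ψ (hy0 n).le).toLp _) with hF
  -- `F n → 𝖥ψ` in `L²`
  have hFlim : Tendsto F atTop (𝓝 (suzukiFourierL2 ψ)) := by
    rw [tendsto_iff_norm_sub_tendsto_zero]
    have h0 : Tendsto (fun n : ℕ ↦ 1 / ((n : ℝ) + 1)) atTop (𝓝 0) :=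
      tendsto_one_div_add_atTop_nhds_zero_nat
    refine squeeze_zero (fun n ↦ norm_nonneg _) (fun n ↦ ?_) h0
    exact (hyn n (hy0 n)).le
  -- a.e. convergence along a subsequence
  obtain ⟨ns, hns, hae⟩ := (tendstoInMeasure_of_tendsto_Lp hFlim).exists_seq_tendsto_ae
  have hyns : Tendsto (fun k ↦ y (ns k)) atTop (𝓝 0) := by
    have h0 : Tendsto (fun k : ℕ ↦ 1 / ((ns k : ℝ) + 1)) atTop (𝓝 0) :=
      tendsto_one_div_add_atTop_nhds_zero_nat.comp hns.tendsto_atTop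
    exact squeeze_zero (fun k ↦ (hy0 _).le) (fun k ↦ (hy1 _).le) h0
  -- the coefficients `F n x = ψ̂(x + i y n)` a.e.
  have hFpt : ∀ᵐ x : ℝ, ∀ n : ℕ, (F n : ℝ → ℂ) x = upperHalfHat ψ ((x : ℂ) + I * y n) := by
    rw [ae_all_iff]
    intro n
    exact suzukiFourierL2_indicator_mul_exp_ae_eq ψ (hy0 n)
  filter_upwards [hae, hFpt, ae_lagariasE_ofReal_ne_zero] with x h1 h2 hEx
  -- pointwise limit `Φ(x + iy)/E(x + iy) → Φ(x)/E(x)`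
  have hpath : Tendsto (fun k ↦ (x : ℂ) + I * y (ns k)) atTop (𝓝 (x : ℂ)) := by
    have : Tendsto (fun k ↦ (x : ℂ) + I * ((y (ns k) : ℝ) : ℂ)) atTop (𝓝 ((x : ℂ) + I * ((0 : ℝ) : ℂ))) :=
      tendsto_const_nhds.add (tendsto_const_nhds.mul (Complex.continuous_ofReal.tendsto _ |>.comp hyns))
    simpa using this
  have hlim2 : Tendsto (fun k ↦ Φ ((x : ℂ) + I * y (ns k)) / lagariasE ((x : ℂ) + I * y (ns k))) atTop
      (𝓝 (Φ x / lagariasE x)) :=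
    ((hΦc x).tendsto.comp hpath).div ((continuous_lagariasE.tendsto _).comp hpath) hEx
  have hEev : ∀ᶠ k in atTop, lagariasE ((x : ℂ) + I * y (ns k)) ≠ 0 :=
    ((continuous_lagariasE.tendsto _).comp hpath).eventually_ne hEx
  have heq : ∀ᶠ k in atTop, (F (ns k) : ℝ → ℂ) x =
      Φ ((x : ℂ) + I * y (ns k)) / lagariasE ((x : ℂ) + I * y (ns k)) := by
    filter_upwards [hEev] with k hEz
    have him : 0 < ((x : ℂ) + I * y (ns k)).im := by simpa using hy0 (ns k)
    rw [h2 (ns k), hΦ _ him, mul_div_cancel_left₀ _ hEz]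
  exact (tendsto_nhds_unique (h1.congr' heq) hlim2).symm

end Literature.NumberTheory.LFunctions
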